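import Summits.ResolutionOfSingularities.ResolutionOfSingularities.Theorems.MarkedTransferCampaignW46MohWindowSurfaceInstance
import HarnessLib

/-!
# [OURS · L1 W4.6, rung (i)/(all n) — brick 25] Affine `(n+1)`-space and the Fermat atom `z^p + Σ_{i<n} u_i^d`: the singular
# locus is the origin, of embedding dimension `n + 1` (scheme level, EVERY `n ≥ 1`)
# (cell res-hironaka, LADDER-RESOLUTION rung L, D-0089; slot W4.6, seat res-L1-s46-pv-2 gen 4; host route `WildCones`,
# crux `ClassicalRegimes` stmt-ResolutionOfSingularities-16884, `--supports … --as helper`)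

HONEST FRAMING. Everything here is OURS: kernel bookkeeping on OUR explicit model (affine space `Spec K[x_0,…,x_n]`, the
polynomial `x_n^p + Σ_{i<n} x_i^d`), generalising res-L1-s46-pv-13's / res-D-pv-029's dimension-3 files
(`…MohWindowSurfaceInstance`, `…ThreefoldsWitness`) to every number of variables; row-001 carriers (`idealOrder`, `sing`,
`IsStandard`) enter as DEFINITIONS. NOTHING here is a statement of H. Hironaka's manuscript [Hironaka2017]; no FACT-LIST
premise. AI review is weaker than expert review.

## Why

Brick 22 (p537008) gives the forced-atom rung WITH A NUMBER in EVERY dimension `n ≥ 1`, but the tree's kernel witnesses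
that `Regime.forcedAtom n` is inhabited exist only for `n = 1` (p521837, 𝔸²) and `n = 2` (p522706, 𝔸³). This file is the
scheme half of the witness for EVERY `n`: on `𝔸^{n+1}_K = Spec K[x_0, …, x_n]` the hypersurface exponent
`E = ((x_n^p + Σ_{i<n} x_i^d)·𝒪, p)` with `p < d`, `p ∤ d` has `Sing(E) = {origin}` (every scheme point, closed or not), the
origin is a closed point with regular local ring of embedding dimension `n + 1`, and `E` is standard. (The companion brick
turns this into `Regime.forcedAtom n (𝔸^{n+1}) E` through Cohen coordinates.)

## What is proved (`R = MvPolynomial (Fin (n+1)) K`, `z = X (Fin.last n)`, `u_i = X (Fin.castSucc i)`)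

* ring level: `hasseDerivAlong_castSucc_fermat` (`(∂/∂u_i)^{(1)} F = d·u_i^{d−1}`), `originIdeal_le_of_mul_fermat_mem_sq`
  (a prime `P` with `s ∉ P`, `s·F ∈ P²` is the origin; `2 ≤ d`, `p ∤ d`), `mul_fermat_not_mem_originIdeal_pow_succ`
  (`s(0) ≠ 0 ⇒ s·F ∉ 𝔪₀^{p+1}`), `fermat_mem_originIdeal_pow`, `fermat_ne_zero`;
* scheme level on `Zs R = Spec R`: `asIdeal_eq_of_two_le_idealOrder`, `idealOrder_origin` (`= p`), `mem_sing_iff`,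
  `sing_subsingleton`, `sing_nonempty`, `mem_closedPoints_origin`, `isStandard`, `smooth_spec`, `isRegularLocalRing_stalk`,
  `ringKrullDim_stalk_origin` (`= n + 1`), `spanFinrank_maximalIdeal_stalk_origin` (`= n + 1`), `maximalIdeal_stalk_origin`,
  `stalkIdeal_eq_span`.

References: res-L1-s46-pv-13 / res-D-pv-029 (the `n = 2` template, cited lemma by lemma), tree `Lib/SpecOrders`
(`shf`, `idealOrder`, `exists_mul_mem_pow_of_le_idealOrder`), `Resolution/OriginLocalRing`, `HasseSchmidt*`;
O. Zariski, P. Samuel, *Commutative Algebra* II, Ch. VIII §1 (orders of ideals). [ZariskiSamuel1960] [folklore]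
-/

noncomputable section

-- single-problem summit: the doubled namespace component `ResolutionOfSingularities` is forced
set_option linter.dupNamespace false

open scoped BigOperators Classical
open CategoryTheory AlgebraicGeometry TopologicalSpace IsLocalRing MvPolynomial
open Literature.AlgebraicGeometry.Resolution Scheme.IdealSheafData
open Literature.AlgebraicGeometry.Hironaka2017.SpecOrders
open Literature.AlgebraicGeometry.Hironaka2017.S02Preliminaries
open Literature.AlgebraicGeometry.Hironaka2017

universe u

namespace Summit.ResolutionOfSingularities.ResolutionOfSingularities.Theorems

namespace CampaignW46.AffineFermat

open CampaignW46.SurfacePlane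

variable (p : ℕ) (K : Type u) [Field K] (n : ℕ)

/-! ## §1 Ring level -/

/-- `(∂/∂u_i)^{(1)} (z^p + Σ_j u_j^d) = d·u_i^{d−1}` in `K[u_0,…,u_{n−1},z]` (`z = X (Fin.last n)`, `u_i = X i.castSucc`).
[folklore] -/
theorem hasseDerivAlong_castSucc_fermat (d : ℕ) (i : Fin n) :
    (hasseDerivAlong K (Fin.castSucc i)).op 1
        (X (Fin.last n) ^ p + ∑ j : Fin n, X (Fin.castSucc j) ^ d : MvPolynomial (Fin (n + 1)) K) =
      (d : MvPolynomial (Fin (n + 1)) K) * X (Fin.castSucc i) ^ (d - 1) := by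
  rw [hasseDerivAlong_op, map_add, map_sum, X_pow_eq_monomial (n := Fin.last n),
    hasseDeriv_monomial_eq_zero_of_not_le, zero_add, Finset.sum_eq_single i]
  · rw [hasseDeriv_X_pow, Nat.choose_one_right]
  · intro j _ hj
    rw [X_pow_eq_monomial, hasseDeriv_monomial_eq_zero_of_not_le]
    intro h
    have h0 := h (Fin.castSucc i)
    simp [Fin.castSucc_inj, hj] at h0
  · intro hi
    exact absurd (Finset.mem_univ i) hi
  · intro h
    have h0 := h (Fin.castSucc i)
    simp at h0

/-- **The derivation step**: for a prime `P ⊆ K[u,z]`, `s ∉ P` and `s·(z^p + Σ u_i^d) ∈ P²`: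
`P ⊇ (u_0, …, u_{n−1}, z)`, i.e. `P` is the origin (`2 ≤ d`, `p ∤ d`). [cite: ZariskiSamuel1960, Vol. II Ch. VIII §1 (orders of ideals; kernel bookkeeping on OUR model)] -/
theorem originIdeal_le_of_mul_fermat_mem_sq [CharP K p] {d : ℕ} (h2d : 2 ≤ d) (hd : ¬ p ∣ d)
    {P : Ideal (MvPolynomial (Fin (n + 1)) K)} [hP : P.IsPrime] {s : MvPolynomial (Fin (n + 1)) K} (hs : s ∉ P)
    (h : s * (X (Fin.last n) ^ p + ∑ j : Fin n, X (Fin.castSucc j) ^ d) ∈ P ^ 2) : originIdeal K (n + 1) ≤ P := by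
  have hgP : (X (Fin.last n) ^ p + ∑ j : Fin n, X (Fin.castSucc j) ^ d : MvPolynomial (Fin (n + 1)) K) ∈ P :=
    (hP.mem_or_mem (Ideal.pow_le_self two_ne_zero h)).resolve_left hs
  have hx : ∀ i : Fin n, (X (Fin.castSucc i) : MvPolynomial (Fin (n + 1)) K) ∈ P := fun i =>
    X_mem_of_mul_mem_sq K hs h (Fin.castSucc i) (isUnit_natCast p K hd) (by omega)
      (hasseDerivAlong_castSucc_fermat p K n d i)
  have hz : (X (Fin.last n) : MvPolynomial (Fin (n + 1)) K) ∈ P := by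
    have hzp : (X (Fin.last n) : MvPolynomial (Fin (n + 1)) K) ^ p ∈ P := by
      have hsum : (∑ j : Fin n, X (Fin.castSucc j) ^ d : MvPolynomial (Fin (n + 1)) K) ∈ P :=
        P.sum_mem fun j _ => Ideal.pow_mem_of_mem P (hx j) d (by omega)
      have h' := Ideal.sub_mem P hgP hsum
      rwa [add_sub_cancel_right] at h'
    exact hP.mem_of_pow_mem p hzp
  rw [originIdeal_eq_span, Ideal.span_le]
  rintro _ ⟨j, rfl⟩
  by_cases hj : j = Fin.last n
  · rw [hj]; exact hz
  · rw [← Fin.castSucc_castPred j hj]; exact hx _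

/-- **No `s` with `s(0) ≠ 0` multiplies `z^p + Σ u_i^d` (`p < d`) into `𝔪₀^{p+1}`**: the `z^p`-coefficient of `s·F` is `s(0)`.
[folklore] -/
theorem mul_fermat_not_mem_originIdeal_pow_succ {d : ℕ} (hpd : p < d) {s : MvPolynomial (Fin (n + 1)) K}
    (hs : s ∉ originIdeal K (n + 1)) :
    s * (X (Fin.last n) ^ p + ∑ j : Fin n, X (Fin.castSucc j) ^ d) ∉ originIdeal K (n + 1) ^ (p + 1) := by
  intro h
  rw [originIdeal_eq_idealOfVars, mem_pow_idealOfVars_iff'] at h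
  have hc := h (Finsupp.single (Fin.last n) p) (by simp)
  have hsum : coeff (Finsupp.single (Fin.last n) p)
      (s * ∑ j : Fin n, (X (Fin.castSucc j) ^ d : MvPolynomial (Fin (n + 1)) K)) = 0 := by
    rw [Finset.mul_sum, coeff_sum]
    refine Finset.sum_eq_zero fun j _ => ?_
    rw [X_pow_eq_monomial, coeff_mul_monomial', if_neg]
    intro hle
    have := hle (Fin.castSucc j)
    rw [Finsupp.single_eq_same, Finsupp.single_eq_of_ne (Fin.castSucc_lt_last j).ne] at this
    omega
  rw [mul_add, coeff_add, hsum, add_zero, X_pow_eq_monomial, coeff_mul_monomial', if_pos le_rfl, tsub_self,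
    mul_one] at hc
  exact hs ((mem_originIdeal_iff K (n + 1)).mpr hc)

/-- `z^p + Σ u_i^d ≠ 0` (`p < d`). [folklore] -/
theorem fermat_ne_zero {d : ℕ} (hpd : p < d) :
    (X (Fin.last n) ^ p + ∑ j : Fin n, X (Fin.castSucc j) ^ d : MvPolynomial (Fin (n + 1)) K) ≠ 0 := by
  intro h
  have h1 := mul_fermat_not_mem_originIdeal_pow_succ p K n hpd (s := 1)
    (fun h1 => (originIdeal.isMaximal (F := K) (n := n + 1)).ne_top ((Ideal.eq_top_iff_one _).mpr h1))
  rw [h, mul_zero] at h1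
  exact h1 (zero_mem _)

/-- `z^p + Σ u_i^d ∈ (u, z)^p` for `p ≤ d`. [folklore] -/
theorem fermat_mem_originIdeal_pow {d : ℕ} (hpd : p ≤ d) :
    (X (Fin.last n) ^ p + ∑ j : Fin n, X (Fin.castSucc j) ^ d : MvPolynomial (Fin (n + 1)) K) ∈
      originIdeal K (n + 1) ^ p := by
  have hX : ∀ i : Fin (n + 1), (X i : MvPolynomial (Fin (n + 1)) K) ∈ originIdeal K (n + 1) := fun i => by
    rw [mem_originIdeal_iff, constantCoeff_X]
  exact add_mem (Ideal.pow_mem_pow (hX _) p)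
    (Ideal.sum_mem _ fun j _ => Ideal.pow_le_pow_right hpd (Ideal.pow_mem_pow (hX _) d))

/-! ## §2 Scheme level: `Sing = {origin}` on `𝔸^{n+1}_K` -/

/-- **Off the origin the order is `≤ 1`**: a point `𝔓` of `Spec K[u,z]` with `ord_𝔓((z^p + Σ u_i^d)·𝒪) ≥ 2` is the origin
(`2 ≤ d`, `p ∤ d`; every scheme point). [cite: ZariskiSamuel1960, Vol. II Ch. VIII §1 (orders of ideals; kernel bookkeeping on OUR model)] -/
theorem asIdeal_eq_of_two_le_idealOrder [CharP K p] {d : ℕ} (h2d : 2 ≤ d) (hd : ¬ p ∣ d)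
    {x : Zs (MvPolynomial (Fin (n + 1)) K)}
    (h : ((2 : ℕ) : ℕ∞) ≤ idealOrder (shf (MvPolynomial (Fin (n + 1)) K)
      (Ideal.span {X (Fin.last n) ^ p + ∑ j : Fin n, X (Fin.castSucc j) ^ d})) x) :
    x.asIdeal = originIdeal K (n + 1) := by
  obtain ⟨s, hs, hsg⟩ := exists_mul_mem_pow_of_le_idealOrder (MvPolynomial (Fin (n + 1)) K)
    (Ideal.span {X (Fin.last n) ^ p + ∑ j : Fin n, X (Fin.castSucc j) ^ d}) x 2 h _ (Ideal.mem_span_singleton_self _)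
  haveI := x.isPrime
  exact ((originIdeal.isMaximal (F := K) (n := n + 1)).eq_of_le x.isPrime.ne_top
    (originIdeal_le_of_mul_fermat_mem_sq p K n h2d hd hs hsg)).symm

/-- **`ord₀ = p` EXACTLY at the origin** (`p < d`). [cite: ZariskiSamuel1960, Vol. II Ch. VIII §1 (orders of ideals; kernel bookkeeping on OUR model)] -/
theorem idealOrder_origin {d : ℕ} (hpd : p < d) {x : Zs (MvPolynomial (Fin (n + 1)) K)}
    (hx : x.asIdeal = originIdeal K (n + 1)) :
    idealOrder (shf (MvPolynomial (Fin (n + 1)) K)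
      (Ideal.span {X (Fin.last n) ^ p + ∑ j : Fin n, X (Fin.castSucc j) ^ d})) x = p := by
  refine le_antisymm ?_ ?_
  · by_contra h
    rw [not_le] at h
    have h1 : ((p + 1 : ℕ) : ℕ∞) ≤ idealOrder (shf (MvPolynomial (Fin (n + 1)) K)
        (Ideal.span {X (Fin.last n) ^ p + ∑ j : Fin n, X (Fin.castSucc j) ^ d})) x := by
      exact_mod_cast Order.add_one_le_of_lt h
    obtain ⟨s, hs, hsg⟩ := exists_mul_mem_pow_of_le_idealOrder (MvPolynomial (Fin (n + 1)) K) _ _ (p + 1) h1 _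
      (Ideal.mem_span_singleton_self _)
    rw [hx] at hs hsg
    exact mul_fermat_not_mem_originIdeal_pow_succ p K n hpd hs hsg
  · refine le_idealOrder_shf_of_le_pow (MvPolynomial (Fin (n + 1)) K) _ _ p ?_
    rw [Ideal.span_le, Set.singleton_subset_iff, SetLike.mem_coe, hx]
    exact fermat_mem_originIdeal_pow p K n hpd.le

/-- **`Sing(E) = {origin}`, pointwise**: a point of `𝔸^{n+1}_K` is singular for `E = ((z^p + Σ u_i^d)·𝒪, p)` iff it is the
origin (`p` prime, `p < d`, `p ∤ d`). [folklore] -/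
theorem mem_sing_iff [Fact p.Prime] [CharP K p] {d : ℕ} (hpd : p < d) (hd : ¬ p ∣ d)
    (x : Zs (MvPolynomial (Fin (n + 1)) K)) :
    x ∈ (⟨shf (MvPolynomial (Fin (n + 1)) K) (Ideal.span {X (Fin.last n) ^ p + ∑ j : Fin n, X (Fin.castSucc j) ^ d}), p⟩ :
        IdealExponent (Zs (MvPolynomial (Fin (n + 1)) K))).sing ↔
      x.asIdeal = originIdeal K (n + 1) := by
  have hp : p.Prime := Fact.out
  change (p : ℕ∞) ≤ idealOrder _ x ↔ _
  constructor
  · intro h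
    refine asIdeal_eq_of_two_le_idealOrder p K n (by have := hp.two_le; omega) hd (le_trans ?_ h)
    exact_mod_cast hp.two_le
  · intro hx
    exact (idealOrder_origin p K n hpd hx).symm.le

/-- `Sing(E)` is a subsingleton. [folklore] -/
theorem sing_subsingleton [Fact p.Prime] [CharP K p] {d : ℕ} (hpd : p < d) (hd : ¬ p ∣ d) :
    (⟨shf (MvPolynomial (Fin (n + 1)) K) (Ideal.span {X (Fin.last n) ^ p + ∑ j : Fin n, X (Fin.castSucc j) ^ d}), p⟩ :
        IdealExponent (Zs (MvPolynomial (Fin (n + 1)) K))).sing.Subsingleton := by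
  intro x hx y hy
  rw [mem_sing_iff p K n hpd hd] at hx hy
  exact PrimeSpectrum.ext (hx.trans hy.symm)

/-- `Sing(E)` is non-empty: the origin. [folklore] -/
theorem sing_nonempty [Fact p.Prime] [CharP K p] {d : ℕ} (hpd : p < d) (hd : ¬ p ∣ d) :
    (⟨shf (MvPolynomial (Fin (n + 1)) K) (Ideal.span {X (Fin.last n) ^ p + ∑ j : Fin n, X (Fin.castSucc j) ^ d}), p⟩ :
        IdealExponent (Zs (MvPolynomial (Fin (n + 1)) K))).sing.Nonempty :=
  ⟨⟨originIdeal K (n + 1), (originIdeal.isMaximal (F := K) (n := n + 1)).isPrime⟩, (mem_sing_iff p K n hpd hd _).mpr rfl⟩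

/-- The origin is a closed point (row 001 `closedPoints`). [folklore] -/
theorem mem_closedPoints_of_asIdeal_eq {x : Zs (MvPolynomial (Fin (n + 1)) K)} (hx : x.asIdeal = originIdeal K (n + 1)) :
    x ∈ Literature.AlgebraicGeometry.Hironaka2017.S02Preliminaries.closedPoints (Zs (MvPolynomial (Fin (n + 1)) K)) := by
  have hmax : x.asIdeal.IsMaximal := by rw [hx]; exact originIdeal.isMaximal (F := K) (n := n + 1)
  exact (PrimeSpectrum.isClosed_singleton_iff_isMaximal x).mpr hmax

/-- **`E` is standard** (`J ≠ (0)`, `b = p > 0`). [folklore] -/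
theorem isStandard [Fact p.Prime] {d : ℕ} (hpd : p < d) :
    (⟨shf (MvPolynomial (Fin (n + 1)) K) (Ideal.span {X (Fin.last n) ^ p + ∑ j : Fin n, X (Fin.castSucc j) ^ d}), p⟩ :
        IdealExponent (Zs (MvPolynomial (Fin (n + 1)) K))).IsStandard := by
  refine ⟨fun h => ?_, (Fact.out : p.Prime).pos⟩
  have h1 := shf_ideal_top (MvPolynomial (Fin (n + 1)) K)
    (Ideal.span {(X (Fin.last n) ^ p + ∑ j : Fin n, X (Fin.castSucc j) ^ d : MvPolynomial (Fin (n + 1)) K)})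
  rw [show shf (MvPolynomial (Fin (n + 1)) K) (Ideal.span {X (Fin.last n) ^ p + ∑ j : Fin n, X (Fin.castSucc j) ^ d}) = ⊥
    from h, Scheme.IdealSheafData.ideal_bot, Pi.bot_apply, eq_comm, Ideal.map_span, Set.image_singleton,
    Ideal.span_singleton_eq_bot] at h1
  exact fermat_ne_zero p K n hpd (by simpa only [ofΓ_toΓ, map_zero] using congrArg (ofΓ (MvPolynomial (Fin (n + 1)) K)) h1)

/-! ## §3 The ambient `𝔸^{n+1}` and the stalk at the origin -/

/-- `Spec K[x_0,…,x_n] → Spec K` is smooth (a polynomial algebra is smooth). [folklore] -/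
theorem smooth_spec : Smooth (Spec.map (CommRingCat.ofHom (algebraMap K (MvPolynomial (Fin (n + 1)) K)))) := by
  rw [HasRingHomProperty.Spec_iff (P := @Smooth)]
  have : Algebra.Smooth K (MvPolynomial (Fin (n + 1)) K) := {}
  exact RingHom.smooth_algebraMap.mpr this

/-- `𝒪_{𝔸^{n+1},𝔓}` is a regular local ring at every point. [cite: StacksProject, Tag 056S (Lemma 33.25.3)] -/
theorem isRegularLocalRing_stalk [Fact p.Prime] [CharP K p] (x : Zs (MvPolynomial (Fin (n + 1)) K)) :
    IsRegularLocalRing ((Zs (MvPolynomial (Fin (n + 1)) K)).presheaf.stalk x) :=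
  (⟨(Fact.out : p.Prime).pos, inferInstanceAs (IrreducibleSpace (PrimeSpectrum (MvPolynomial (Fin (n + 1)) K))),
    smooth_spec K n, inferInstance⟩ :
      IsAmbient p (Spec.map (CommRingCat.ofHom (algebraMap K (MvPolynomial (Fin (n + 1)) K))))).isRegularLocalRing_stalk x

/-- `dim 𝒪_{𝔸^{n+1},0} = n + 1`. [folklore] -/
theorem ringKrullDim_stalk_origin {x : Zs (MvPolynomial (Fin (n + 1)) K)} (hx : x.asIdeal = originIdeal K (n + 1)) :
    ringKrullDim ((Zs (MvPolynomial (Fin (n + 1)) K)).presheaf.stalk x) = ((n + 1 : ℕ) : WithBot ℕ∞) := by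
  rw [show ringKrullDim ((Zs (MvPolynomial (Fin (n + 1)) K)).presheaf.stalk x) =
      ringKrullDim (St (MvPolynomial (Fin (n + 1)) K) x) from rfl,
    IsLocalization.AtPrime.ringKrullDim_eq_height x.asIdeal (St (MvPolynomial (Fin (n + 1)) K) x), hx,
    ← IsLocalization.AtPrime.ringKrullDim_eq_height (originIdeal K (n + 1)) (OriginLocalization K (n + 1)),
    ringKrullDim_originLocalization]

/-- `emb dim 𝒪_{𝔸^{n+1},0} = n + 1`. [cite: Matsumura1987, Thm. 14.2 (regular local rings; kernel bookkeeping on OUR model)] -/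
theorem spanFinrank_maximalIdeal_stalk_origin [Fact p.Prime] [CharP K p] {x : Zs (MvPolynomial (Fin (n + 1)) K)}
    (hx : x.asIdeal = originIdeal K (n + 1)) :
    (maximalIdeal ((Zs (MvPolynomial (Fin (n + 1)) K)).presheaf.stalk x)).spanFinrank = n + 1 := by
  haveI := isRegularLocalRing_stalk p K n x
  have h := IsRegularLocalRing.spanFinrank_maximalIdeal (R := (Zs (MvPolynomial (Fin (n + 1)) K)).presheaf.stalk x)
  rw [ringKrullDim_stalk_origin K n hx] at h
  exact_mod_cast h

/-- **`𝔪_0 = (x_0/1, …, x_n/1)`** in `𝒪_{𝔸^{n+1},0}`. [cite: Matsumura1987, §5 Example 1 / Thm. 14.2 (kernel bookkeeping on OUR model)] -/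
theorem maximalIdeal_stalk_origin {x : Zs (MvPolynomial (Fin (n + 1)) K)} (hx : x.asIdeal = originIdeal K (n + 1)) :
    maximalIdeal ((Zs (MvPolynomial (Fin (n + 1)) K)).presheaf.stalk x) =
      Ideal.span (Set.range fun i : Fin (n + 1) =>
        algebraMap (MvPolynomial (Fin (n + 1)) K) (St (MvPolynomial (Fin (n + 1)) K) x) (X i)) := by
  rw [show maximalIdeal ((Zs (MvPolynomial (Fin (n + 1)) K)).presheaf.stalk x) =
      maximalIdeal (St (MvPolynomial (Fin (n + 1)) K) x) from rfl, maximalIdeal_St, hx, originIdeal_eq_span, Ideal.map_span,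
    ← Set.range_comp]
  rfl

/-- **The stalk of `(z^p + Σ u_i^d)·𝒪` at any point is generated by the germ of the polynomial.**
[cite: Hartshorne1977, Ch. II Prop. 2.2 (stalks of Spec R are the localisations; kernel bookkeeping on OUR model)] -/
theorem stalkIdeal_eq_span (d : ℕ) (x : Zs (MvPolynomial (Fin (n + 1)) K)) :
    stalkIdeal (shf (MvPolynomial (Fin (n + 1)) K) (Ideal.span {X (Fin.last n) ^ p + ∑ j : Fin n, X (Fin.castSucc j) ^ d})) x =
      Ideal.span {algebraMap (MvPolynomial (Fin (n + 1)) K) (St (MvPolynomial (Fin (n + 1)) K) x)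
        (X (Fin.last n) ^ p + ∑ j : Fin n, X (Fin.castSucc j) ^ d)} := by
  rw [stalkIdeal_shf, Ideal.map_span, Set.image_singleton]

end CampaignW46.AffineFermat

end Summit.ResolutionOfSingularities.ResolutionOfSingularities.Theorems

end
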